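import Summits.ValiantsHypothesis.ValiantsHypothesis.Theorems.LacunarySymmetroidMatrixDescartesCensusDoorA34KernelPlanes
import Summits.ValiantsHypothesis.ValiantsHypothesis.Theorems.LacunarySymmetroidMatrixDescartesCensusDoorA34Box12IIII
import Summits.ValiantsHypothesis.ValiantsHypothesis.Theorems.LacunarySymmetroidMatrixDescartesCensusSignClass

/-!
# `MatrixDescartes` census — DOOR A at `(3,4)`: the plane law made concrete — at most nine kernel lines of a nineteen lie in a plane on which
# some letter is nonsingular

HONEST FRAMING.  Object-search cell `pub-symmetroid`, route `LacunarySymmetroid`; beside the OPEN typed statement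
`Theses.LacunarySymmetroid.DoorA34` (stmt-ValiantsHypothesis-19980, `= DoorA34 = PosRootLawAt 3 4 18`), asserted nowhere.  `…KernelPlanes` proved: at most
nine positive det-roots of a real symmetric `(3,4)` pencil have their kernel line in a plane `c^⊥` PROVIDED the `10`-nomial `g_c = cᵀ adj P(x) c` is not
identically zero.  This file discharges that proviso from ONE LETTER, for all supports and with no definiteness hypothesis:

* `coeff_adjugate_pencil_apply_sq`, `coeff_quadForm_adjugate_pencil_sq` — on an exponent `2·d k` that is uniquely a pair sum, the coefficient of
  `X^{2 d k}` in `(adj P)_{ij}` is `(adj S_k)_{ij}`, hence in `g_c` it is `cᵀ adj S_k c` (tree `Census.coeff_det_pencil_two_diag` on the `2 × 2` sub-pencils);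
* `quadForm_adjugate_pencil_ne_zero_of_letter` — so `g_c ≠ 0` as soon as `cᵀ adj S_k c ≠ 0` for some letter whose square exponent is uniquely represented;
* **`card_roots_kernel_orthogonal_le_nine_of_nineteen`** — for a symmetric `(3,4)` pencil with `19` distinct positive det-roots (all square exponents are then
  uniquely represented, `cube_unique_of_nineteen`) and a direction `c` with `cᵀ adj S_k c ≠ 0` for SOME letter `k` (the compression of `S_k` to the plane `c^⊥` is
  nonsingular), at most NINE positive det-roots have their kernel line inside `c^⊥`.  Left open (successor): the fully degenerate planes on which all four
  letters are singular (there `g_c ≡ 0` is possible only with a fixed-direction rank-one compression, which caps the root count at `6` — not formalised).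

NOTHING here bounds `ζ_sym(3,4)`; `DoorA34` stays OPEN; nothing bears on `MatrixDescartes` (stmt-ValiantsHypothesis-18050) or on `VP ≠ VNP`.
[folklore] Coefficient bookkeeping; no citation is needed.
-/

-- `Summit.ValiantsHypothesis.ValiantsHypothesis.…` repeats a component by the D-0017 layout
-- (single-conjunct summit), which the `dupNamespace` linter flags; the name is mandated.
set_option linter.dupNamespace false

namespace Summit.ValiantsHypothesis.ValiantsHypothesis.Theorems.LacunarySymmetroidMatrixDescartes.Census

open Polynomial Finset
open scoped BigOperators Polynomial Matrix

/-- **The square exponent of letter `k` carries `(adj S_k)_{ij}` in `(adj P)_{ij}`** (when `2·d k` is uniquely a pair sum). [folklore] -/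
theorem coeff_adjugate_pencil_apply_sq {K : ℕ} (d : Fin K → ℕ) (S : Fin K → Matrix (Fin 3) (Fin 3) ℝ) (k : Fin K)
    (huniq : ∀ p : Fin K × Fin K, d p.1 + d p.2 = d k + d k → p = (k, k)) (i j : Fin 3) :
    ((∑ l, ((X : ℝ[X]) ^ d l) • (S l).map C).adjugate i j).coeff (d k + d k) = (S k).adjugate i j := by
  have e1 : ((-1 : ℝ[X]) ^ (j + i : ℕ)) = C ((-1 : ℝ) ^ (j + i : ℕ)) := by simp
  rw [Matrix.adjugate_fin_succ_eq_det_submatrix, Matrix.adjugate_fin_succ_eq_det_submatrix, submatrix_pencil₂, e1,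
    Polynomial.coeff_C_mul, coeff_det_pencil_two_diag d _ k huniq, Matrix.det_fin_two]

/-- **The square exponent of letter `k` carries `cᵀ adj S_k c` in `g_c`.** [folklore] -/
theorem coeff_quadForm_adjugate_pencil_sq {K : ℕ} (d : Fin K → ℕ) (S : Fin K → Matrix (Fin 3) (Fin 3) ℝ) (k : Fin K)
    (huniq : ∀ p : Fin K × Fin K, d p.1 + d p.2 = d k + d k → p = (k, k)) (c : Fin 3 → ℝ) :
    (∑ i, ∑ j, C (c i * c j) * (∑ l, ((X : ℝ[X]) ^ d l) • (S l).map C).adjugate i j).coeff (d k + d k)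
      = c ⬝ᵥ ((S k).adjugate *ᵥ c) := by
  simp only [Polynomial.finsetSum_coeff, Polynomial.coeff_C_mul, coeff_adjugate_pencil_apply_sq d S k huniq,
    dotProduct, Matrix.mulVec, Finset.mul_sum]
  refine Finset.sum_congr rfl fun i _ => Finset.sum_congr rfl fun j _ => ?_
  ring

/-- **`g_c ≠ 0` from one letter**: if `2·d k` is uniquely a pair sum and `cᵀ adj S_k c ≠ 0`, the `10`-nomial `g_c` is not zero. [folklore] -/
theorem quadForm_adjugate_pencil_ne_zero_of_letter {K : ℕ} (d : Fin K → ℕ) (S : Fin K → Matrix (Fin 3) (Fin 3) ℝ) (k : Fin K)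
    (huniq : ∀ p : Fin K × Fin K, d p.1 + d p.2 = d k + d k → p = (k, k)) (c : Fin 3 → ℝ)
    (hk : c ⬝ᵥ ((S k).adjugate *ᵥ c) ≠ 0) :
    (∑ i, ∑ j, C (c i * c j) * (∑ l, ((X : ℝ[X]) ^ d l) • (S l).map C).adjugate i j) ≠ 0 := by
  intro h0
  apply hk
  rw [← coeff_quadForm_adjugate_pencil_sq d S k huniq c, h0, Polynomial.coeff_zero]

/-- For a `(3,4)` nineteen every square exponent `2·d k` is uniquely a pair sum (from `cube_unique_of_nineteen`). [folklore] -/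
theorem pairSum_sq_unique_of_nineteen (d : Fin 4 → ℕ) (S : Fin 4 → Matrix (Fin 3) (Fin 3) ℝ)
    (h19 : 19 ≤ ((Matrix.det (∑ l, ((X : ℝ[X]) ^ d l) • (S l).map C)).roots.toFinset.filter (fun t => 0 < t)).card)
    (k : Fin 4) : ∀ p : Fin 4 × Fin 4, d p.1 + d p.2 = d k + d k → p = (k, k) := by
  intro p hp
  have hcube := cube_unique_of_nineteen d S h19 k (![p.1, p.2, k]) (by
    simp only [Fin.sum_univ_three, Matrix.cons_val_zero, Matrix.cons_val_one, Matrix.head_cons, Matrix.cons_val_two,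
      Matrix.tail_cons]
    omega)
  have h1 := hcube 0
  have h2 := hcube 1
  simp only [Matrix.cons_val_zero, Matrix.cons_val_one] at h1 h2
  exact Prod.ext h1 h2

/-- **AT MOST NINE KERNEL LINES OF A NINETEEN IN A PLANE ON WHICH SOME LETTER IS NONSINGULAR.**  Let `P = Σ_l X^{d l} S_l` (real symmetric `3 × 3`
letters, any support) have `19` distinct positive det-roots, and let `c` be a direction with `cᵀ adj S_k c ≠ 0` for some letter `k` (the compression of
`S_k` to the plane `c^⊥` is nonsingular).  Then at most nine positive det-roots `r` admit a kernel vector `u ≠ 0`, `P(r) u = 0`, with `c ⊥ u`. [folklore] -/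
theorem card_roots_kernel_orthogonal_le_nine_of_nineteen (d : Fin 4 → ℕ) (S : Fin 4 → Matrix (Fin 3) (Fin 3) ℝ)
    (hS : ∀ l, (S l).IsSymm)
    (h19 : 19 ≤ ((Matrix.det (∑ l, ((X : ℝ[X]) ^ d l) • (S l).map C)).roots.toFinset.filter (fun t => 0 < t)).card)
    (c : Fin 3 → ℝ) (hk : ∃ k, c ⬝ᵥ ((S k).adjugate *ᵥ c) ≠ 0)
    (T : Finset ℝ) (hT : ∀ r ∈ T, 0 < r)
    (hker : ∀ r ∈ T, ∃ u : Fin 3 → ℝ, u ≠ 0 ∧ (∑ l, r ^ d l • S l) *ᵥ u = 0 ∧ c ⬝ᵥ u = 0) : T.card ≤ 9 := by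
  obtain ⟨k, hk⟩ := hk
  exact card_roots_kernel_orthogonal_le_nine d S hS c
    (quadForm_adjugate_pencil_ne_zero_of_letter d S k (pairSum_sq_unique_of_nineteen d S h19 k) c hk) T hT hker

end Summit.ValiantsHypothesis.ValiantsHypothesis.Theorems.LacunarySymmetroidMatrixDescartes.Census
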